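import Mathlib
import HarnessLib

/-!
# Dzindzalieta–Juškevičius–Šileikis (2012), Theorem 1.1: the OPTIMAL tail inequality for Rademacher sums with
# bounded coefficients — `P{a₁ε₁ + ⋯ + aₙεₙ ≥ x} ≤ P{W_n ≥ x}` if `⌈x⌉ + n` is even, `≤ P{W_{n−1} ≥ x}` if odd
# (`|aᵢ| ≤ 1`, `x > 0`, `W_m` the simple random walk with `m` steps)

Topic `Probability/Independence` (sibling of `LevyInequalities.lean`, `EtemadiInequality.lean`); namespace
`Literature.Probability.Independence.RademacherTail`. FULLY PROVED — no named fact, no axiom.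

SOURCE (held: `paper:arxiv-1111.6332`, pp. 1–4). D. Dzindzalieta, T. Juškevičius, M. Šileikis, *Optimal probability
inequalities for random walks related to problems in extremal combinatorics*, SIAM J. Discrete Math. **26** (2012)
828–837 [DzindzalietaJuskeviciusSileikis2012]. Abstract, verbatim: «Let `S_n = X_1 + ⋯ + X_n` be a sum of independent
symmetric random variables such that `|X_i| ≤ 1`. Denote by `W_n = ε_1 + ⋯ + ε_n` a sum of independent random variables
such that `P{ε_i = ±1} = 1/2`. We prove that `P{S_n ∈ A} ≤ P{cW_k ∈ A}`, where `A` is either an interval of the form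
`[x, ∞)` or just a single point. The inequality is exact and the optimal values of `c` and `k` are given explicitly.»
Theorem 1.1 (p. 2), verbatim: «For `x > 0` we have `P{S_n ≥ x} ≤ P{W_n ≥ x}` if `⌈x⌉ + n ∈ 2ℤ`, and
`P{S_n ≥ x} ≤ P{W_{n−1} ≥ x}` if `⌈x⌉ + n ∈ 2ℤ + 1`.» Proof (§2, p. 4), verbatim: «First note that the inequality is
true for `x ∈ (0,1]` and all `n`. This is due to the fact that `P{S_n ≥ x} ≤ 1/2` by symmetry of `S_n` and for all
`n` the right-hand side of the inequality is given by the tail of an odd number of random signs, which is exactly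
`1/2`. We can also assume that the largest coefficient `a_i = 1` as otherwise if we scale the sum by `a_i` then the
tail of the this new sum would be at least as large as the former. […] Define a function `I(x,n)` to be `1` if
`⌈x⌉ + n` is even, and zero otherwise. Then we can rewrite the right-hand side of (1) as `P{W_{n−1} + ε_n I(x,n) ≥ x}`,
making an agreement `ε_0 ≡ 0`. For `x > 1` we argue by induction on `n`. Case `n = 0` is trivial. Observing that
`I(x−1,n) = I(x+1,n) = I(x,n+1)` we have `P{S_{n+1} ≥ x} = ½P{S_n ≥ x−1} + ½P{S_n ≥ x+1} ≤ ½P{W_{n−1} +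
ε_n I(x−1,n) ≥ x−1} + ½P{W_{n−1} + ε_n I(x+1,n) ≥ x+1} = P{W_n + ε_{n+1} I(x,n+1) ≥ x}`.» By Lemma 2.1 of the
paper the Rademacher case `X_i = a_i ε_i` is the essential one; THIS FILE TYPES THAT CASE (the consumer — the
`pqc` cell's ML-DSA-44 `c·t₀` rejection bound — has exactly such sums).

HOW IT IS TYPED (finite combinatorics, no measure theory). Sign vectors are `ε : ι → Bool` on a finite index type
(`true ↦ +1`, `false ↦ −1`, `sgn`); `radSum a ε = Σ_i sgn(ε i)·a i`; the tail COUNT `tailCount a x = #{ε : x ≤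
radSum a ε}` (a sum of indicators), so that `P{S_n ≥ x} = tailCount a x / 2^n`; `walkTail n x = P{W_n ≥ x}` is the
all-ones case on `Fin n`; `djsBound n x` = the printed right-hand side (`walkTail n x` if `⌈x⌉ + n` even, else
`walkTail (n − 1) x`; at `n = 0` both branches read `P{0 ≥ x}`, the paper's `ε_0 ≡ 0`).
* **`tailCount_le_two_pow_mul_djsBound`** (Theorem 1.1, counting form on `Fin n`) and **`tailProb_le_djsBound`**
  (any finite index type): `|a i| ≤ 1`, `0 < x` ⇒ `#{ε : x ≤ Σ aᵢεᵢ} ≤ 2^n · djsBound n x`.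
* steps of the printed proof as lemmas: `two_mul_tailCount_le` (`P{S_n ≥ x} ≤ ½` for `x > 0`),
  `pow_le_two_mul_tailCount_of_odd` (an odd walk has `P{W_m ≥ x} ≥ ½` for `x ∈ (0,1]`), `tailCount_le_tailCount_div`
  (scaling by the largest coefficient), `tailCount_update_neg` / `tailCount_comp_equiv` (sign and permutation
  symmetries), `tailCount_cons` (the conditioning step `P{S_{n+1} ≥ x} = ½P{S_n ≥ x − a} + ½P{S_n ≥ x + a}`),
  `djsBound_succ` (the identity `½R(x−1,n) + ½R(x+1,n) = R(x,n+1)` for `x > 1`).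
* consumer forms: `tailCount_le_of_abs_le` (coefficients `|u i| ≤ B`, threshold `T`: bound `2^n · djsBound n (T/B)`),
  `absTailCount_le_of_abs_le` (two-sided, factor `2`), and `walkTail_eq_sum_choose` (the binomial evaluation
  `P{W_n ≥ x} = 2^{−n} Σ_{j : n − 2j ≥ x} C(n, j)`, for numeric instances).
NOT typed: Lemma 2.1 (reduction of general symmetric `|X_i| ≤ 1` to the Rademacher case), Theorems 1.2–1.3
(point probabilities, Littlewood–Offord), §3–§4 (extremal-combinatorics proofs, Lipschitz extension).
-/

noncomputable section

open Finset

namespace Literature.Probability.Independence.RademacherTail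

/-! ## §1. Sign vectors, Rademacher sums, tail counts -/

/-- The sign `±1` encoded by a Boolean (`true ↦ 1`, `false ↦ −1`). [cite: DzindzalietaJuskeviciusSileikis2012, §1 (P{ε_i = ±1} = 1/2)] -/
def sgn (b : Bool) : ℝ := if b then 1 else -1

/-- `sgn true = 1`. [cite: DzindzalietaJuskeviciusSileikis2012, §1] -/
@[simp] theorem sgn_true : sgn true = 1 := rfl

/-- `sgn false = −1`. [cite: DzindzalietaJuskeviciusSileikis2012, §1] -/
@[simp] theorem sgn_false : sgn false = -1 := rfl

/-- Flipping the Boolean negates the sign. [cite: DzindzalietaJuskeviciusSileikis2012, §1] -/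
theorem sgn_not (b : Bool) : sgn (!b) = -sgn b := by cases b <;> simp

/-- `|sgn b| = 1`. [cite: DzindzalietaJuskeviciusSileikis2012, §1] -/
theorem abs_sgn (b : Bool) : |sgn b| = 1 := by cases b <;> simp

/-- `sgn b = 2·[b] − 1`. [cite: DzindzalietaJuskeviciusSileikis2012, §1] -/
theorem sgn_eq_two_mul_sub (b : Bool) : sgn b = 2 * (if b = true then (1 : ℝ) else 0) - 1 := by
  cases b <;> norm_num

variable {ι : Type*} [Fintype ι] [DecidableEq ι]

/-- The Rademacher sum `S = Σ_i a_i ε_i` at the sign vector `ε`. [cite: DzindzalietaJuskeviciusSileikis2012, §2 (S_n = a_1ε_1 + ⋯ + a_nε_n)] -/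
def radSum (a : ι → ℝ) (ε : ι → Bool) : ℝ := ∑ i, sgn (ε i) * a i

/-- The TAIL COUNT `#{ε ∈ {±1}^ι : x ≤ Σ_i a_i ε_i}` (so that `P{S ≥ x} = tailCount a x / 2^{#ι}`).
[cite: DzindzalietaJuskeviciusSileikis2012, §1 Thm 1.1 (P{S_n ≥ x})] -/
def tailCount (a : ι → ℝ) (x : ℝ) : ℕ := ∑ ε : ι → Bool, if x ≤ radSum a ε then 1 else 0

/-- The tail PROBABILITY `P{Σ_i a_i ε_i ≥ x}` under independent uniform signs. [cite: DzindzalietaJuskeviciusSileikis2012, §1 Thm 1.1] -/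
def tailProb (a : ι → ℝ) (x : ℝ) : ℝ := (tailCount a x : ℝ) / 2 ^ Fintype.card ι

/-- `P{W_n ≥ x}` for the simple random walk with `n` steps. [cite: DzindzalietaJuskeviciusSileikis2012, §1 (W_n)] -/
def walkTail (n : ℕ) (x : ℝ) : ℝ := (tailCount (fun _ : Fin n ↦ (1 : ℝ)) x : ℝ) / 2 ^ n

/-- The printed right-hand side `R(x, n)`: `P{W_n ≥ x}` if `⌈x⌉ + n` is even, `P{W_{n−1} ≥ x}` otherwise (at `n = 0`
both branches are `P{0 ≥ x}`, the paper's convention `ε_0 ≡ 0`). [cite: DzindzalietaJuskeviciusSileikis2012, §1 Thm 1.1 eq. (1) and §2 (I(x,n))] -/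
def djsBound (n : ℕ) (x : ℝ) : ℝ := if Even (⌈x⌉ + (n : ℤ)) then walkTail n x else walkTail (n - 1) x

omit [DecidableEq ι] in
/-- Flipping every sign negates the sum. [cite: DzindzalietaJuskeviciusSileikis2012, §2 (symmetry of S_n)] -/
theorem radSum_not (a : ι → ℝ) (ε : ι → Bool) : radSum a (fun i ↦ !ε i) = -radSum a ε := by
  simp [radSum, sgn_not, Finset.sum_neg_distrib]

omit [DecidableEq ι] in
/-- Negating the coefficients negates the sum. [cite: DzindzalietaJuskeviciusSileikis2012, §2] -/
theorem radSum_neg (a : ι → ℝ) (ε : ι → Bool) : radSum (-a) ε = -radSum a ε := by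
  simp [radSum, Finset.sum_neg_distrib]

omit [DecidableEq ι] in
/-- Dividing the coefficients divides the sum. [cite: DzindzalietaJuskeviciusSileikis2012, §2 (scaling)] -/
theorem radSum_div (a : ι → ℝ) (α : ℝ) (ε : ι → Bool) : radSum (fun i ↦ a i / α) ε = radSum a ε / α := by
  simp [radSum, Finset.sum_div, mul_div_assoc]

omit [DecidableEq ι] in
/-- The all-ones sum is `2·#{i : ε_i = +1} − #ι` (an integer of the parity of `#ι`).
[cite: DzindzalietaJuskeviciusSileikis2012, §2 (W_n is a sum of n signs)] -/
theorem radSum_one (ε : ι → Bool) :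
    radSum (fun _ ↦ (1 : ℝ)) ε = 2 * ((univ.filter fun i ↦ ε i = true).card : ℝ) - Fintype.card ι := by
  simp only [radSum, mul_one, sgn_eq_two_mul_sub, Finset.sum_sub_distrib, ← Finset.mul_sum, Finset.sum_boole,
    Finset.sum_const, Finset.card_univ, nsmul_eq_mul, mul_one]

/-- The involution «flip every sign». [cite: DzindzalietaJuskeviciusSileikis2012, §2 (symmetry)] -/
def flipAll : (ι → Bool) ≃ (ι → Bool) where
  toFun ε i := !ε i
  invFun ε i := !ε i
  left_inv ε := by funext i; simp
  right_inv ε := by funext i; simp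

/-- `#{ε : x ≤ −S(ε)} = #{ε : x ≤ S(ε)}` (flip every sign). [cite: DzindzalietaJuskeviciusSileikis2012, §2 (symmetry of S_n)] -/
theorem sum_indicator_neg (a : ι → ℝ) (x : ℝ) :
    (∑ ε : ι → Bool, if x ≤ -radSum a ε then 1 else 0 : ℕ) = tailCount a x := by
  unfold tailCount
  conv_rhs => rw [← Equiv.sum_comp flipAll]
  refine Finset.sum_congr rfl fun ε _ ↦ ?_
  have h : radSum a (flipAll ε) = -radSum a ε := radSum_not a ε
  rw [h]

/-- `tailCount (−a) x = tailCount a x`. [cite: DzindzalietaJuskeviciusSileikis2012, §2 (symmetry)] -/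
theorem tailCount_neg (a : ι → ℝ) (x : ℝ) : tailCount (-a) x = tailCount a x := by
  rw [← sum_indicator_neg a x]
  unfold tailCount
  simp_rw [radSum_neg]

/-- `tailCount a x ≤ 2^{#ι}`. [cite: DzindzalietaJuskeviciusSileikis2012, §1] -/
theorem tailCount_le (a : ι → ℝ) (x : ℝ) : tailCount a x ≤ 2 ^ Fintype.card ι := by
  unfold tailCount
  calc _ ≤ ∑ _ε : ι → Bool, 1 := Finset.sum_le_sum fun ε _ ↦ by split_ifs <;> simp
    _ = 2 ^ Fintype.card ι := by simp

/-- `0 ≤ walkTail n x ≤ 1`-type bookkeeping: `walkTail n x ≤ 1`. [cite: DzindzalietaJuskeviciusSileikis2012, §1] -/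
theorem walkTail_le_one (n : ℕ) (x : ℝ) : walkTail n x ≤ 1 := by
  unfold walkTail
  rw [div_le_one (by positivity)]
  have h := tailCount_le (fun _ : Fin n ↦ (1 : ℝ)) x
  rw [Fintype.card_fin] at h
  exact_mod_cast h

/-- `0 ≤ walkTail n x`. [cite: DzindzalietaJuskeviciusSileikis2012, §1] -/
theorem walkTail_nonneg (n : ℕ) (x : ℝ) : 0 ≤ walkTail n x := by
  unfold walkTail; positivity

/-- `0 ≤ djsBound n x`. [cite: DzindzalietaJuskeviciusSileikis2012, §1 Thm 1.1] -/
theorem djsBound_nonneg (n : ℕ) (x : ℝ) : 0 ≤ djsBound n x := by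
  unfold djsBound; split_ifs <;> exact walkTail_nonneg _ _

/-- `djsBound n x ≤ 1`. [cite: DzindzalietaJuskeviciusSileikis2012, §1 Thm 1.1] -/
theorem djsBound_le_one (n : ℕ) (x : ℝ) : djsBound n x ≤ 1 := by
  unfold djsBound; split_ifs <;> exact walkTail_le_one _ _

/-! ## §2. The steps of the printed proof -/

/-- **Symmetry step**: `P{S ≥ x} ≤ ½` for `x > 0`, i.e. `2·#{x ≤ S} ≤ 2^{#ι}` (the events `{x ≤ S}` and `{x ≤ −S}` are
disjoint and equinumerous). [cite: DzindzalietaJuskeviciusSileikis2012, §2 proof of Thm 1.1 («P{S_n ≥ x} ≤ 1/2 by symmetry of S_n»)] -/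
theorem two_mul_tailCount_le (a : ι → ℝ) {x : ℝ} (hx : 0 < x) : 2 * tailCount a x ≤ 2 ^ Fintype.card ι := by
  rw [two_mul]
  nth_rewrite 2 [← sum_indicator_neg a x]
  unfold tailCount
  rw [← Finset.sum_add_distrib]
  calc _ ≤ ∑ _ε : ι → Bool, 1 := Finset.sum_le_sum fun ε _ ↦ by
          split_ifs with h1 h2
          · exfalso; linarith
          all_goals simp
    _ = 2 ^ Fintype.card ι := by simp

/-- **Odd walks**: for `m` odd and `x ∈ (0, 1]`, `P{W_m ≥ x} ≥ ½`, i.e. `2^m ≤ 2·#{x ≤ W_m}` (`W_m` is an odd integer, so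
`{x ≤ W_m} ∪ {x ≤ −W_m}` is everything). [cite: DzindzalietaJuskeviciusSileikis2012, §2 proof of Thm 1.1 («the tail of an odd number of random signs, which is exactly 1/2»)] -/
theorem pow_le_two_mul_tailCount_of_odd {m : ℕ} (hm : Odd m) {x : ℝ} (hx1 : x ≤ 1) :
    2 ^ m ≤ 2 * tailCount (fun _ : Fin m ↦ (1 : ℝ)) x := by
  rw [two_mul]
  nth_rewrite 2 [← sum_indicator_neg _ x]
  unfold tailCount
  rw [← Finset.sum_add_distrib]
  calc 2 ^ m = ∑ _ε : Fin m → Bool, 1 := by simp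
    _ ≤ _ := Finset.sum_le_sum fun ε _ ↦ ?_
  have hW := radSum_one ε
  rw [Fintype.card_fin] at hW
  obtain ⟨r, hr⟩ := hm
  have hmr : (m : ℝ) = 2 * r + 1 := by exact_mod_cast hr
  have hcase : x ≤ radSum (fun _ : Fin m ↦ (1 : ℝ)) ε ∨ x ≤ -radSum (fun _ : Fin m ↦ (1 : ℝ)) ε := by
    rw [hW, hmr]
    rcases le_or_gt (r + 1) (univ.filter fun i ↦ ε i = true).card with h | h
    · left
      have h' : (r : ℝ) + 1 ≤ ((univ.filter fun i ↦ ε i = true).card : ℝ) := by exact_mod_cast h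
      linarith
    · right
      have h' : ((univ.filter fun i ↦ ε i = true).card : ℝ) ≤ r := by exact_mod_cast Nat.lt_succ_iff.mp h
      linarith
  rcases hcase with h | h
  · rw [if_pos h]; exact Nat.le_add_right 1 _
  · rw [if_pos h]; exact Nat.le_add_left 1 _

/-- **Scaling step**: for `0 < α ≤ 1` and `x > 0`, `#{x ≤ S_a} ≤ #{x ≤ S_{a/α}}` («if we scale the sum by `a_i` then the tail
of the this new sum would be at least as large as the former»). [cite: DzindzalietaJuskeviciusSileikis2012, §2 proof of Thm 1.1 (scaling)] -/
theorem tailCount_le_tailCount_div (a : ι → ℝ) {α : ℝ} (hα0 : 0 < α) (hα1 : α ≤ 1) {x : ℝ} (hx : 0 < x) :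
    tailCount a x ≤ tailCount (fun i ↦ a i / α) x := by
  unfold tailCount
  refine Finset.sum_le_sum fun ε _ ↦ ?_
  by_cases h : x ≤ radSum a ε
  · have h' : x ≤ radSum (fun i ↦ a i / α) ε := by
      rw [radSum_div]
      exact h.trans (le_div_self (hx.le.trans h) hα0 hα1)
    rw [if_pos h, if_pos h']
  · rw [if_neg h]; exact Nat.zero_le _

/-- **Exact scaling**: `#{T ≤ S_u} = #{T/B ≤ S_{u/B}}` for `B > 0`. [cite: DzindzalietaJuskeviciusSileikis2012, §2 proof of Thm 1.1 (scaling)] -/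
theorem tailCount_div (u : ι → ℝ) {B : ℝ} (hB : 0 < B) (T : ℝ) :
    tailCount (fun i ↦ u i / B) (T / B) = tailCount u T := by
  unfold tailCount
  refine Finset.sum_congr rfl fun ε _ ↦ ?_
  simp only [radSum_div, div_le_div_iff_of_pos_right hB]

/-- **Permutation / relabelling symmetry**: the tail count is invariant under a bijection of the index type.
[cite: DzindzalietaJuskeviciusSileikis2012, §2 proof of Thm 1.1 («without loss of generality … a_1 ≤ a_2 ≤ … ≤ a_n»)] -/
theorem tailCount_comp_equiv {κ : Type*} [Fintype κ] [DecidableEq κ] (e : ι ≃ κ) (a : κ → ℝ) (x : ℝ) :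
    tailCount (a ∘ e) x = tailCount a x := by
  unfold tailCount
  have h : ∀ ε : ι → Bool, radSum (a ∘ e) ε = radSum a (ε ∘ e.symm) := fun ε ↦ by
    unfold radSum
    rw [← Equiv.sum_comp e]
    simp
  simp_rw [h]
  exact Equiv.sum_comp (e.arrowCongr (Equiv.refl Bool)) (fun η : κ → Bool ↦ if x ≤ radSum a η then 1 else 0)

/-- The involution «flip the sign at `i₀`». [cite: DzindzalietaJuskeviciusSileikis2012, §2 (symmetry)] -/
def flipAt (i₀ : ι) : (ι → Bool) ≃ (ι → Bool) where
  toFun ε := Function.update ε i₀ (!ε i₀)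
  invFun ε := Function.update ε i₀ (!ε i₀)
  left_inv ε := by
    funext i
    by_cases hi : i = i₀
    · subst hi; simp
    · simp [Function.update_of_ne hi]
  right_inv ε := by
    funext i
    by_cases hi : i = i₀
    · subst hi; simp
    · simp [Function.update_of_ne hi]

/-- **Sign symmetry at one coordinate**: replacing `a_{i₀}` by `−a_{i₀}` does not change the tail count (flip `ε_{i₀}`).
[cite: DzindzalietaJuskeviciusSileikis2012, §2 proof of Thm 1.1 («without loss of generality … 0 ≤ a_1»)] -/
theorem tailCount_update_neg (a : ι → ℝ) (i₀ : ι) (x : ℝ) :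
    tailCount (Function.update a i₀ (-a i₀)) x = tailCount a x := by
  have key : ∀ ε : ι → Bool, radSum (Function.update a i₀ (-a i₀)) ε = radSum a (flipAt i₀ ε) := by
    intro ε
    unfold radSum
    rw [← Finset.add_sum_erase _ _ (mem_univ i₀), ← Finset.add_sum_erase _ _ (mem_univ i₀)]
    congr 1
    · simp [flipAt, sgn_not]
    · refine Finset.sum_congr rfl fun i hi ↦ ?_
      have hne : i ≠ i₀ := ne_of_mem_erase hi
      simp [flipAt, Function.update_of_ne hne]
  unfold tailCount
  simp_rw [key]
  exact Equiv.sum_comp (flipAt i₀) (fun η : ι → Bool ↦ if x ≤ radSum a η then 1 else 0)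

/-- **Conditioning step**: splitting off one coordinate with coefficient `c`,
`#{x ≤ S_{(c,a)}} = #{x − c ≤ S_a} + #{x + c ≤ S_a}` (`P{S_{n+1} ≥ x} = ½P{S_n ≥ x − c} + ½P{S_n ≥ x + c}`).
[cite: DzindzalietaJuskeviciusSileikis2012, §2 proof of Thm 1.1 (P{S_{n+1} ≥ x} = ½P{S_n ≥ x−1} + ½P{S_n ≥ x+1})] -/
theorem tailCount_cons {n : ℕ} (c : ℝ) (a : Fin n → ℝ) (x : ℝ) :
    tailCount (Fin.cons c a : Fin (n + 1) → ℝ) x = tailCount a (x - c) + tailCount a (x + c) := by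
  have hrad : ∀ (b : Bool) (η : Fin n → Bool),
      radSum (Fin.cons c a : Fin (n + 1) → ℝ) (Fin.cons b η) = sgn b * c + radSum a η := by
    intro b η
    simp [radSum, Fin.sum_univ_succ]
  unfold tailCount
  rw [← Fintype.sum_equiv (Fin.consEquiv fun _ ↦ Bool)
    (fun p ↦ if x ≤ radSum (Fin.cons c a : Fin (n + 1) → ℝ) (Fin.cons p.1 p.2) then 1 else 0)
    (fun ε ↦ if x ≤ radSum (Fin.cons c a : Fin (n + 1) → ℝ) ε then 1 else 0) (fun p ↦ rfl)]
  rw [Fintype.sum_prod_type, Fintype.sum_bool]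
  simp_rw [hrad]
  congr 1
  · refine Finset.sum_congr rfl fun η _ ↦ ?_
    simp only [sgn_true, one_mul, sub_le_iff_le_add']
  · refine Finset.sum_congr rfl fun η _ ↦ ?_
    simp only [sgn_false, neg_one_mul, neg_add_eq_sub, le_sub_iff_add_le]

/-- The all-ones vector on `Fin (n+1)` is `Fin.cons 1 (all-ones)` (plumbing). [folklore] -/
private theorem cons_one_eq (n : ℕ) : (Fin.cons (1 : ℝ) (fun _ : Fin n ↦ (1 : ℝ)) : Fin (n + 1) → ℝ) = fun _ ↦ 1 := by
  funext i
  refine Fin.cases ?_ (fun j ↦ ?_) i <;> simp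

/-- **The walk recursion** `P{W_{m+1} ≥ x} = ½P{W_m ≥ x − 1} + ½P{W_m ≥ x + 1}`.
[cite: DzindzalietaJuskeviciusSileikis2012, §2 proof of Thm 1.1 (last display)] -/
theorem walkTail_succ (m : ℕ) (x : ℝ) : walkTail (m + 1) x = (walkTail m (x - 1) + walkTail m (x + 1)) / 2 := by
  unfold walkTail
  rw [← cons_one_eq m, tailCount_cons, pow_succ]
  push_cast
  ring

/-- `P{W_0 ≥ x} = 0` for `x > 0`. [cite: DzindzalietaJuskeviciusSileikis2012, §2 proof of Thm 1.1 («Case n = 0 is trivial»)] -/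
theorem walkTail_zero {x : ℝ} (hx : 0 < x) : walkTail 0 x = 0 := by
  unfold walkTail tailCount
  simp [radSum, not_le.mpr hx]

/-- **The identity `½R(x−1, n) + ½R(x+1, n) = R(x, n+1)` for `x > 1`** («Observing that `I(x−1,n) = I(x+1,n) = I(x,n+1)`»).
[cite: DzindzalietaJuskeviciusSileikis2012, §2 proof of Thm 1.1] -/
theorem djsBound_succ (n : ℕ) {x : ℝ} (hx : 1 < x) :
    djsBound (n + 1) x = (djsBound n (x - 1) + djsBound n (x + 1)) / 2 := by
  unfold djsBound
  rw [Int.ceil_sub_one, Int.ceil_add_one]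
  by_cases h : Even (⌈x⌉ + ((n + 1 : ℕ) : ℤ))
  · have h1 : Even (⌈x⌉ - 1 + (n : ℤ)) := by
      rw [even_iff_two_dvd] at h ⊢; push_cast at h; omega
    have h2 : Even (⌈x⌉ + 1 + (n : ℤ)) := by
      rw [even_iff_two_dvd] at h ⊢; push_cast at h; omega
    rw [if_pos h, if_pos h1, if_pos h2, walkTail_succ]
  · have h1 : ¬Even (⌈x⌉ - 1 + (n : ℤ)) := by
      rw [even_iff_two_dvd] at h ⊢; push_cast at h; omega
    have h2 : ¬Even (⌈x⌉ + 1 + (n : ℤ)) := by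
      rw [even_iff_two_dvd] at h ⊢; push_cast at h; omega
    rw [if_neg h, if_neg h1, if_neg h2, Nat.add_sub_cancel]
    cases n with
    | zero =>
      simp only [Nat.zero_sub]
      rw [walkTail_zero (by linarith), walkTail_zero (by linarith), walkTail_zero (by linarith)]
      norm_num
    | succ m =>
      rw [Nat.add_sub_cancel, walkTail_succ]

/-- **`R(x, n) ≥ ½` for `x ∈ (0,1]` and `n ≥ 1`** (the relevant walk has an odd number of steps).
[cite: DzindzalietaJuskeviciusSileikis2012, §2 proof of Thm 1.1 («exactly 1/2»)] -/
theorem half_le_djsBound {n : ℕ} (hn : 1 ≤ n) {x : ℝ} (hx0 : 0 < x) (hx1 : x ≤ 1) : 1 / 2 ≤ djsBound n x := by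
  have hceil : ⌈x⌉ = 1 := by
    rw [Int.ceil_eq_iff]; constructor <;> push_cast <;> linarith
  have key : ∀ m : ℕ, Odd m → 1 / 2 ≤ walkTail m x := by
    intro m hm
    unfold walkTail
    rw [le_div_iff₀ (by positivity)]
    have h := pow_le_two_mul_tailCount_of_odd hm hx1
    have h' : ((2 ^ m : ℕ) : ℝ) ≤ ((2 * tailCount (fun _ : Fin m ↦ (1 : ℝ)) x : ℕ) : ℝ) := by exact_mod_cast h
    push_cast at h'
    linarith
  unfold djsBound
  rw [hceil]
  split_ifs with h
  · refine key n ?_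
    rw [even_iff_two_dvd] at h
    rw [Nat.odd_iff]
    omega
  · refine key (n - 1) ?_
    rw [even_iff_two_dvd] at h
    rw [Nat.odd_iff]
    omega

/-! ## §3. Theorem 1.1 -/

/-- **DJS12 THEOREM 1.1 (Rademacher case), counting form on `Fin n`**: for real coefficients `|a_i| ≤ 1` and `x > 0`,
`#{ε ∈ {±1}^n : Σ a_i ε_i ≥ x} ≤ 2^n · R(x, n)` with `R(x,n) = P{W_n ≥ x}` (`⌈x⌉ + n` even) / `P{W_{n−1} ≥ x}` (odd). The
printed proof: symmetry for `x ≤ 1`; for `x > 1` normalise the largest `|a_i|` to `1` (scaling, a sign flip, a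
relabelling), condition on that sign, induct. [cite: DzindzalietaJuskeviciusSileikis2012, §1 Thm 1.1 and §2 (proof)] -/
theorem tailCount_le_two_pow_mul_djsBound (n : ℕ) (a : Fin n → ℝ) (ha : ∀ i, |a i| ≤ 1) {x : ℝ} (hx : 0 < x) :
    (tailCount a x : ℝ) ≤ 2 ^ n * djsBound n x := by
  induction n generalizing x with
  | zero =>
    have h0 : tailCount a x = 0 := by
      unfold tailCount; simp [radSum, not_le.mpr hx]
    rw [h0, Nat.cast_zero]
    exact mul_nonneg (by positivity) (djsBound_nonneg _ _)
  | succ n ih =>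
    by_cases hx1 : x ≤ 1
    · -- `x ∈ (0,1]`: symmetry
      have h1 := two_mul_tailCount_le a hx
      rw [Fintype.card_fin] at h1
      have h1' : (2 : ℝ) * tailCount a x ≤ 2 ^ (n + 1) := by exact_mod_cast h1
      have h2 := half_le_djsBound (n := n + 1) (by omega) hx hx1
      calc (tailCount a x : ℝ) ≤ 2 ^ (n + 1) * (1 / 2) := by linarith
        _ ≤ 2 ^ (n + 1) * djsBound (n + 1) x := by gcongr
    · -- `x > 1`: normalise the largest coefficient and condition on its sign
      rw [not_le] at hx1
      have hαle : ∀ i, |a i| ≤ univ.sup' univ_nonempty (fun i ↦ |a i|) :=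
        fun i ↦ Finset.le_sup' (fun i ↦ |a i|) (mem_univ i)
      have hα1 : univ.sup' univ_nonempty (fun i ↦ |a i|) ≤ 1 := Finset.sup'_le _ _ (fun i _ ↦ ha i)
      obtain ⟨i₀, -, hi₀⟩ := Finset.exists_mem_eq_sup' univ_nonempty (fun i ↦ |a i|)
      rw [hi₀] at hαle hα1
      -- `hαle : ∀ i, |a i| ≤ |a i₀|`, `hα1 : |a i₀| ≤ 1`
      set α : ℝ := |a i₀| with hαdef
      by_cases hα0 : a i₀ = 0
      · -- all coefficients vanish: the event `x ≤ 0` is empty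
        have hzero : ∀ i, a i = 0 := fun i ↦
          abs_eq_zero.mp (le_antisymm (by simpa [hαdef, hα0] using hαle i) (abs_nonneg _))
        have h0 : tailCount a x = 0 := by
          unfold tailCount; simp [radSum, hzero, not_le.mpr hx]
        rw [h0, Nat.cast_zero]
        exact mul_nonneg (by positivity) (djsBound_nonneg _ _)
      · have hαpos : 0 < α := abs_pos.mpr hα0
        -- (i) scaling by `α = |a i₀|`
        have step1 : tailCount a x ≤ tailCount (fun i ↦ a i / α) x :=
          tailCount_le_tailCount_div a hαpos hα1 hx
        have ha₁le : ∀ i, |a i / α| ≤ 1 := fun i ↦ by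
          rw [abs_div, abs_of_pos hαpos]; exact div_le_one_of_le₀ (hαle i) hαpos.le
        -- (ii) sign flip at `i₀` so that the coefficient there is `+1`
        have step2 : tailCount (Function.update (fun i ↦ a i / α) i₀ 1) x =
            tailCount (fun i ↦ a i / α) x := by
          rcases le_or_gt 0 (a i₀) with hpos | hneg
          · have h1 : a i₀ / α = 1 := by rw [hαdef, abs_of_nonneg hpos, div_self hα0]
            have heq : Function.update (fun i ↦ a i / α) i₀ 1 = fun i ↦ a i / α := by
              funext i
              by_cases hi : i = i₀
              · subst hi; simp [h1]
              · simp [Function.update_of_ne hi]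
            rw [heq]
          · have h1 : -(a i₀ / α) = 1 := by
              rw [hαdef, abs_of_neg hneg, div_neg, neg_neg, div_self hα0]
            rw [← h1]
            exact tailCount_update_neg (fun i ↦ a i / α) i₀ x
        have ha₂le : ∀ i, |Function.update (fun i ↦ a i / α) i₀ 1 i| ≤ 1 := by
          intro i
          by_cases hi : i = i₀
          · subst hi; simp
          · rw [Function.update_of_ne hi]; exact ha₁le i
        have ha₂i₀ : Function.update (fun i ↦ a i / α) i₀ 1 i₀ = 1 := by simp
        -- (iii) relabel so that the normalised coefficient sits at position `0`
        set b : Fin (n + 1) → ℝ := Function.update (fun i ↦ a i / α) i₀ 1 ∘ Equiv.swap 0 i₀ with hb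
        have step3 : tailCount b x = tailCount (Function.update (fun i ↦ a i / α) i₀ 1) x :=
          tailCount_comp_equiv (Equiv.swap 0 i₀) _ x
        have hb0 : b 0 = 1 := by
          simp only [hb, Function.comp_apply, Equiv.swap_apply_left, ha₂i₀]
        have hble : ∀ i, |b i| ≤ 1 := fun i ↦ ha₂le _
        -- (iv) condition on the sign at position `0`
        have step4 : tailCount b x = tailCount (Fin.tail b) (x - 1) + tailCount (Fin.tail b) (x + 1) := by
          conv_lhs => rw [← Fin.cons_self_tail b, hb0]
          exact tailCount_cons 1 (Fin.tail b) x
        have htail : ∀ i, |Fin.tail b i| ≤ 1 := fun i ↦ hble _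
        -- (v) induction hypothesis at `x − 1` and `x + 1`, and the identity for `R`
        have ih1 := ih (Fin.tail b) htail (x := x - 1) (by linarith)
        have ih2 := ih (Fin.tail b) htail (x := x + 1) (by linarith)
        calc (tailCount a x : ℝ) ≤ tailCount (fun i ↦ a i / α) x := by exact_mod_cast step1
          _ = tailCount b x := by rw [step3, step2]
          _ = (tailCount (Fin.tail b) (x - 1) : ℝ) + tailCount (Fin.tail b) (x + 1) := by
              rw [step4]; push_cast; ring
          _ ≤ 2 ^ n * djsBound n (x - 1) + 2 ^ n * djsBound n (x + 1) := add_le_add ih1 ih2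
          _ = 2 ^ (n + 1) * djsBound (n + 1) x := by rw [djsBound_succ n hx1, pow_succ]; ring

/-- **DJS12 THEOREM 1.1 (Rademacher case)** on any finite index type: `|a_i| ≤ 1`, `x > 0` ⇒
`P{Σ_i a_i ε_i ≥ x} ≤ R(x, #ι)` — «among bounded random walks the simple random walk is the most stochastic».
[cite: DzindzalietaJuskeviciusSileikis2012, §1 Thm 1.1] -/
theorem tailProb_le_djsBound (a : ι → ℝ) (ha : ∀ i, |a i| ≤ 1) {x : ℝ} (hx : 0 < x) :
    tailProb a x ≤ djsBound (Fintype.card ι) x := by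
  unfold tailProb
  rw [div_le_iff₀ (by positivity), ← tailCount_comp_equiv (Fintype.equivFin ι).symm a x, mul_comm]
  exact tailCount_le_two_pow_mul_djsBound _ (a ∘ (Fintype.equivFin ι).symm) (fun i ↦ ha _) hx

/-! ## §4. Consumer forms: coefficients bounded by `B`, threshold `T`; two-sided tails; binomial evaluation -/

/-- **Scaled form**: `|u_i| ≤ B` (`B > 0`), `T > 0` ⇒ `#{ε : T ≤ Σ u_i ε_i} ≤ 2^{#ι} · R(T/B, #ι)`.
[cite: DzindzalietaJuskeviciusSileikis2012, §1 Thm 1.1 (applied to a_i = u_i / B, x = T / B)] -/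
theorem tailCount_le_of_abs_le (u : ι → ℝ) {B : ℝ} (hB : 0 < B) (hu : ∀ i, |u i| ≤ B) {T : ℝ} (hT : 0 < T) :
    (tailCount u T : ℝ) ≤ 2 ^ Fintype.card ι * djsBound (Fintype.card ι) (T / B) := by
  rw [← tailCount_div u hB T]
  have h := tailProb_le_djsBound (fun i ↦ u i / B)
    (fun i ↦ by rw [abs_div, abs_of_pos hB]; exact div_le_one_of_le₀ (hu i) hB.le) (div_pos hT hB)
  unfold tailProb at h
  rwa [div_le_iff₀ (by positivity), mul_comm] at h

/-- The TWO-SIDED tail count `#{ε : x ≤ |Σ_i a_i ε_i|}`. [cite: DzindzalietaJuskeviciusSileikis2012, §1 Thm 1.1 (with the symmetry of S_n)] -/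
def absTailCount (a : ι → ℝ) (x : ℝ) : ℕ := ∑ ε : ι → Bool, if x ≤ |radSum a ε| then 1 else 0

/-- `#{x ≤ |S_a|} ≤ #{x ≤ S_a} + #{x ≤ S_{−a}}`. [cite: DzindzalietaJuskeviciusSileikis2012, §1 Thm 1.1 (symmetry)] -/
theorem absTailCount_le (a : ι → ℝ) (x : ℝ) : absTailCount a x ≤ tailCount a x + tailCount (-a) x := by
  unfold absTailCount tailCount
  rw [← Finset.sum_add_distrib]
  refine Finset.sum_le_sum fun ε _ ↦ ?_
  rw [radSum_neg]
  by_cases h : x ≤ |radSum a ε|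
  · rw [if_pos h]
    rcases le_abs'.mp h with h' | h'
    · have h'' : x ≤ -radSum a ε := by linarith
      rw [if_pos h'']; exact Nat.le_add_left 1 _
    · rw [if_pos h']; exact Nat.le_add_right 1 _
  · rw [if_neg h]; exact Nat.zero_le _

/-- **Two-sided scaled form**: `|u_i| ≤ B`, `T > 0` ⇒ `#{ε : T ≤ |Σ u_i ε_i|} ≤ 2 · 2^{#ι} · R(T/B, #ι)`.
[cite: DzindzalietaJuskeviciusSileikis2012, §1 Thm 1.1 (two-sided by symmetry)] -/
theorem absTailCount_le_of_abs_le (u : ι → ℝ) {B : ℝ} (hB : 0 < B) (hu : ∀ i, |u i| ≤ B) {T : ℝ} (hT : 0 < T) :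
    (absTailCount u T : ℝ) ≤ 2 * (2 ^ Fintype.card ι * djsBound (Fintype.card ι) (T / B)) := by
  have h1 := tailCount_le_of_abs_le u hB hu hT
  have h2 := tailCount_le_of_abs_le (-u) hB (fun i ↦ by rw [Pi.neg_apply, abs_neg]; exact hu i) hT
  have h3 : (absTailCount u T : ℝ) ≤ tailCount u T + tailCount (-u) T := by exact_mod_cast absTailCount_le u T
  linarith

omit [DecidableEq ι] in
/-- The all-ones sum is `#ι − 2·#{i : ε_i = −1}`. [cite: DzindzalietaJuskeviciusSileikis2012, §1 (W_n)] -/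
theorem radSum_one_eq_sub (ε : ι → Bool) :
    radSum (fun _ ↦ (1 : ℝ)) ε = Fintype.card ι - 2 * ((univ.filter fun i ↦ ε i = false).card : ℝ) := by
  have h : ∀ b : Bool, sgn b = 1 - 2 * (if b = false then (1 : ℝ) else 0) := fun b ↦ by cases b <;> norm_num
  simp only [radSum, mul_one, h, Finset.sum_sub_distrib, ← Finset.mul_sum, Finset.sum_boole, Finset.sum_const,
    Finset.card_univ, nsmul_eq_mul, mul_one]

/-- The bijection «sign vector ↦ its set of minus signs». [folklore] -/
def minusSet : (ι → Bool) ≃ Finset ι where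
  toFun ε := univ.filter fun i ↦ ε i = false
  invFun s := fun i ↦ decide (i ∉ s)
  left_inv ε := by funext i; cases h : ε i <;> simp [h]
  right_inv s := by ext i; simp

/-- **Binomial evaluation of the walk tail**: `P{W_n ≥ x} = 2^{−n} · Σ_{j ≤ n, n − 2j ≥ x} C(n, j)` (group the sign
vectors by their number `j` of minus signs). [cite: DzindzalietaJuskeviciusSileikis2012, §1 (W_n = ε_1 + ⋯ + ε_n)] -/
theorem walkTail_eq_sum_choose (n : ℕ) (x : ℝ) :
    walkTail n x = (∑ j ∈ Finset.range (n + 1), if x ≤ (n : ℝ) - 2 * j then (n.choose j : ℝ) else 0) / 2 ^ n := by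
  unfold walkTail
  congr 1
  unfold tailCount
  push_cast
  have h1 : ∀ ε : Fin n → Bool, radSum (fun _ ↦ (1 : ℝ)) ε = (n : ℝ) - 2 * ((minusSet ε).card : ℝ) := fun ε ↦ by
    rw [radSum_one_eq_sub, Fintype.card_fin]; rfl
  simp_rw [h1]
  rw [Fintype.sum_equiv minusSet (fun ε ↦ if x ≤ (n : ℝ) - 2 * ((minusSet ε).card : ℝ) then (1 : ℝ) else 0)
    (fun s ↦ if x ≤ (n : ℝ) - 2 * (s.card : ℝ) then (1 : ℝ) else 0) (fun ε ↦ rfl)]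
  rw [← Finset.powerset_univ, Finset.sum_powerset_apply_card (fun m ↦ if x ≤ (n : ℝ) - 2 * (m : ℝ) then (1 : ℝ) else 0),
    Finset.card_univ, Fintype.card_fin]
  refine Finset.sum_congr rfl fun j _ ↦ ?_
  rw [nsmul_eq_mul]
  split_ifs <;> simp

end Literature.Probability.Independence.RademacherTail
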